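import Mathlib
import Summits.QuantumFields.QCD.Theorems.PauliWegnerSeaPhaseQuenchedFlavourDecayEntryMomentFibreBound
import Summits.QuantumFields.QCD.Theorems.PauliWegnerSeaPhaseQuenchedFlavourDecayJacobiMinorNorm

/-!
# All single-flavour Wick minors: the fibre moment reduction, concretely
(lead c5, line `crossing-split-integrability`, crux stmt-QuantumFields-9151 `PauliWegnerSea.PhaseQuenchedFlavourDecay`)

`fibreMomentReduction` bounds `∫ Ψ^{1+ε} ρ dHaar` by `K ∫ (A/M_f)^{1+ε} ρ dHaar` for any fibre-invariant measurable majorant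
`A ≥ Ψ·|det D_f|`; `stub_entryMomentFibreBound` is its `r = 1` instance.  Here `Ψ = ‖det[(D⁻¹)((f,I a),(f,J b))]_{a,b}‖` is an
ARBITRARY same-flavour `r × r` Wick minor — the integrand of the minor-form core `stub_minorMomentsCore` for single-flavour row and
column sets — and `A(U) = sup_W ‖det D_f(refit U W)[J', I']‖` is the two-star fibre supremum of the COMPLEMENTARY minor (rows `J'`
= complement of the columns `J`, columns `I'` = complement of the rows `I`), which dominates `Ψ·|det D_f|` by JACOBI's identity in norm
form (`stub_jacobiMinorNorm`, landed p120222; taken as a hypothesis in the Of-form): `‖det((D_f⁻¹)[I,J])‖·|det D_f| = ‖det D_f[J',I']‖`.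
Result: `stub_minorMomentFibreBound` — at fixed `β ≤ β_max` the minor-form core's bound for every single-flavour Wick minor is implied
by a uniform bound on `E₊[(sup_W ‖det D_f(refit U W)[J',I']‖ / M_f(U))^{1+ε}]`, crux K1's cofactor/determinant ratio at rank `r` in
outside-averaged MOMENT form.
-/

noncomputable section

namespace Summit.QuantumFields.QCD.Cruxes.PhaseQuenchedFlavourDecay.CrossingSplitIntegrability

open scoped BigOperators ENNReal
open MeasureTheory Filter
open Literature.MathematicalPhysics.QuantumFieldTheory Literature.MathematicalPhysics.QuantumLattice
  Literature.Probability.LatticeModels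

/-- **Complementary-minor domination of a Wick minor** (from Jacobi in norm form, hypothesis `hJ`):
`‖det[(D⁻¹)((f,I a),(f,J b))]‖ · |det D_f| ≤ ‖det D_f[J', I']‖` for the `N_f`-flavour matrix `D = diracMatrix U mq`, its flavour-`f`
block `D_f`, injective `I, J` with complements enumerated by `I', J'` (equality where every one-flavour determinant is non-zero; where one
vanishes the left side is `0` — the junk inverse `0` for `r ≥ 1`, a `0 × 0` identity for `r = 0`, or the determinant factor). -/
theorem norm_det_inv_diracMatrix_minor_mul_norm_det_le
    (hJ : ∀ (n : Type) [Fintype n] [DecidableEq n] (r k : ℕ) (M : Matrix n n ℂ) (I J : Fin r → n) (I' J' : Fin k → n), Function.Injective I → Function.Injective J → Function.Injective I' → Function.Injective J' → (∀ a b, I a ≠ I' b) → (∀ a b, J a ≠ J' b) → (∀ x, (∃ a, I a = x) ∨ (∃ b, I' b = x)) → (∀ x, (∃ a, J a = x) ∨ (∃ b, J' b = x)) → M.det ≠ 0 → ‖((M⁻¹).submatrix I J).det‖ * ‖M.det‖ = ‖(M.submatrix J' I').det‖)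
    {L : ℕ} [NeZero L] {Nf : ℕ} (U : GaugeConfig 4 L SU3) (mq : Fin Nf → ℝ) (f : Fin Nf) {r k : ℕ}
    (I J : Fin r → TorusSite 4 L × Fin 3 × Fin 4) (I' J' : Fin k → TorusSite 4 L × Fin 3 × Fin 4)
    (hI : Function.Injective I) (hJi : Function.Injective J) (hI' : Function.Injective I') (hJ' : Function.Injective J')
    (hII' : ∀ a b, I a ≠ I' b) (hJJ' : ∀ a b, J a ≠ J' b) (hcovI : ∀ z, (∃ a, I a = z) ∨ (∃ b, I' b = z))
    (hcovJ : ∀ z, (∃ a, J a = z) ∨ (∃ b, J' b = z)) :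
    ‖(Matrix.of fun a b : Fin r => (diracMatrix U mq)⁻¹ (quarkEquiv (f, I a)) (quarkEquiv (f, J b))).det‖ *
        ‖(wilsonDirac (fundamentalRep (Fin 3)) U (mq f) 1).det‖ ≤
      ‖((wilsonDirac (fundamentalRep (Fin 3)) U (mq f) 1).submatrix J' I').det‖ := by
  set D : Matrix (TorusSite 4 L × Fin 3 × Fin 4) (TorusSite 4 L × Fin 3 × Fin 4) ℂ :=
    wilsonDirac (fundamentalRep (Fin 3)) U (mq f) 1 with hD
  by_cases hf : D.det = 0
  · rw [hf, norm_zero, mul_zero]; exact norm_nonneg _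
  -- the Jacobi value for the one-flavour block
  have hjac : ‖((D⁻¹).submatrix I J).det‖ * ‖D.det‖ = ‖(D.submatrix J' I').det‖ :=
    hJ _ r k D I J I' J' hI hJi hI' hJ' hII' hJJ' hcovI hcovJ hf
  by_cases hall : ∀ g, (wilsonDirac (fundamentalRep (Fin 3)) U (mq g) 1).det ≠ 0
  · -- every flavour invertible: the multi-flavour block IS the one-flavour inverse
    have heq : (Matrix.of fun a b : Fin r => (diracMatrix U mq)⁻¹ (quarkEquiv (f, I a)) (quarkEquiv (f, J b))) =
        (D⁻¹).submatrix I J := by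
      ext a b
      simp only [Matrix.of_apply, Matrix.submatrix_apply, hD, inv_diracMatrix_apply_same_flavour U mq hall f]
    rw [heq, hjac]
  · -- some OTHER flavour is singular (the flavour `f` is not): the multi-flavour inverse is the junk `0`
    push Not at hall
    obtain ⟨g, hg⟩ := hall
    have h0 : (diracMatrix U mq).det = 0 := by
      rw [det_diracMatrix]; exact Finset.prod_eq_zero (Finset.mem_univ g) hg
    have hinv : (diracMatrix U mq)⁻¹ = 0 :=
      Matrix.nonsing_inv_apply_not_isUnit _ (by rw [h0]; exact not_isUnit_zero)
    rcases Nat.eq_zero_or_pos r with hr | hr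
    · -- `r = 0`: both minors are the empty determinant
      subst hr
      have heq : (Matrix.of fun a b : Fin 0 => (diracMatrix U mq)⁻¹ (quarkEquiv (f, I a)) (quarkEquiv (f, J b))) =
          (D⁻¹).submatrix I J := Subsingleton.elim _ _
      rw [heq, hjac]
    · haveI : Nonempty (Fin r) := ⟨⟨0, hr⟩⟩
      have hzero : (Matrix.of fun a b : Fin r => (diracMatrix U mq)⁻¹ (quarkEquiv (f, I a)) (quarkEquiv (f, J b))) = 0 := by
        ext a b; simp [hinv]
      rw [hzero, Matrix.det_zero, norm_zero, zero_mul]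
      exact norm_nonneg _

/-- Joint continuity of a refitted complementary minor: `(W, U) ↦ ‖det D_W(refit U W; m)[J', I']‖`. -/
theorem continuous_norm_det_submatrix_wilsonDirac_refit {L : ℕ} [NeZero L] (star : Edge 4 L → Prop)
    [DecidablePred star] (m : ℝ) {k : ℕ} (J' I' : Fin k → TorusSite 4 L × Fin 3 × Fin 4) :
    Continuous fun pr : GaugeConfig 4 L SU3 × GaugeConfig 4 L SU3 =>
      ‖((wilsonDirac (fundamentalRep (Fin 3)) (fun e => if star e then pr.1 e else pr.2 e) m 1).submatrix J' I').det‖ := by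
  have hρ3 : Continuous (fundamentalRep (Fin 3) : SU3 →* Matrix (Fin 3) (Fin 3) ℂ) :=
    continuous_fundamentalRep (Fin 3)
  have hrefit : Continuous fun pr : GaugeConfig 4 L SU3 × GaugeConfig 4 L SU3 =>
      (fun e => if star e then pr.1 e else pr.2 e : GaugeConfig 4 L SU3) := by
    refine continuous_pi fun e => ?_
    by_cases he : star e
    · simp only [he, if_true]; exact (continuous_apply e).comp continuous_fst
    · simp only [he, if_false]; exact (continuous_apply e).comp continuous_snd
  have hD := (continuous_wilsonDirac (L := L) (fundamentalRep (Fin 3)) hρ3 m 1).comp hrefit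
  have hsub : Continuous fun pr : GaugeConfig 4 L SU3 × GaugeConfig 4 L SU3 =>
      ((wilsonDirac (fundamentalRep (Fin 3)) (fun e => if star e then pr.1 e else pr.2 e) m 1).submatrix J' I') :=
    continuous_pi fun a => continuous_pi fun b => hD.matrix_elem (J' a) (I' b)
  exact hsub.matrix_det.norm

/-- **All single-flavour Wick minors, Of-form** (modulo Jacobi in norm form `hJ` and the fibre moment reduction `hFMR`): the
phase-quenched `(1+ε)`-moment weight integral of `‖det[(D⁻¹)((f,I a),(f,J b))]‖` is at most `K` times that of
`(sup_W ‖det D_f(refit U W)[J',I']‖ / M_f(U))^{1+ε}`. -/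
theorem minorMomentFibreBound_of
    (hJ : ∀ (n : Type) [Fintype n] [DecidableEq n] (r k : ℕ) (M : Matrix n n ℂ) (I J : Fin r → n) (I' J' : Fin k → n), Function.Injective I → Function.Injective J → Function.Injective I' → Function.Injective J' → (∀ a b, I a ≠ I' b) → (∀ a b, J a ≠ J' b) → (∀ x, (∃ a, I a = x) ∨ (∃ b, I' b = x)) → (∀ x, (∃ a, J a = x) ∨ (∃ b, J' b = x)) → M.det ≠ 0 → ‖((M⁻¹).submatrix I J).det‖ * ‖M.det‖ = ‖(M.submatrix J' I').det‖)
    (hFMR : 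
      ∀ (Nf : ℕ) (βmax : ℝ), 0 ≤ βmax → ∃ ε₀ : ℝ, 0 < ε₀ ∧ ∀ ε : ℝ, 0 < ε → ε < ε₀ → ∃ K : ℝ, 0 < K ∧ ∀ β : ℝ, 0 ≤ β →
      β ≤ βmax → ∀ mq : Fin Nf → ℝ, (∀ f, -2 ≤ mq f ∧ mq f ≤ 2) → ∀ (L : ℕ) [NeZero L], 4 ≤ L → ∀ (f : Fin Nf) (x y : TorusSite 4 L) (Ψ A : GaugeConfig 4 L SU3 →
      ℝ), Measurable Ψ → Measurable A → (∀ U, 0 ≤ Ψ U) → (∀ U, 0 ≤ A U) →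
      let star : Edge 4 L → Prop := fun e => e.1 = x ∨ Site.shift e.1 e.2 = x ∨ e.1 = y ∨ Site.shift e.1 e.2 = y;
      let refit : GaugeConfig 4 L SU3 → GaugeConfig 4 L SU3 → GaugeConfig 4 L SU3 := fun U W e => if star e then W e else U e;
      let Ff : GaugeConfig 4 L SU3 → ℝ := fun U => ‖fermionDet (wilsonDirac (fundamentalRep (Fin 3)) U (mq f) 1)‖;
      let G : GaugeConfig 4 L SU3 → ℝ := fun U => ∏ g ∈ Finset.univ.erase f, ‖fermionDet (wilsonDirac (fundamentalRep (Fin 3)) U (mq g) 1)‖;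
      let wt : GaugeConfig 4 L SU3 → ℝ := fun U => Real.exp (-(β * wilsonAction (fundamentalRep (Fin 3)) U));
      let haar : Measure (GaugeConfig 4 L SU3) := Measure.pi fun _ => haarProbability SU3;
      let M : GaugeConfig 4 L SU3 → ℝ := fun U => (∫ W, Ff (refit U W) * G (refit U W) * wt (refit U W) ∂haar) / ∫ W, G (refit U W) * wt (refit U W) ∂haar;
      (∀ U, Ψ U * Ff U ≤ A U) → (∀ U W, A (refit U W) = A U) → ∫⁻ U, ENNReal.ofReal (Ψ U ^ (1 + ε) * (Ff U * G U * wt U)) ∂haar ≤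
      ENNReal.ofReal K * ∫⁻ U, ENNReal.ofReal ((A U / M U) ^ (1 + ε) * (Ff U * G U * wt U)) ∂haar) :
    ∀ (Nf : ℕ) (βmax : ℝ), 0 ≤ βmax → ∃ ε₀ : ℝ, 0 < ε₀ ∧ ∀ ε : ℝ, 0 < ε → ε < ε₀ → ∃ K : ℝ, 0 < K ∧ ∀ β : ℝ, 0 ≤ β →
    β ≤ βmax → ∀ mq : Fin Nf → ℝ, (∀ f, -2 ≤ mq f ∧ mq f ≤ 2) → ∀ (L : ℕ) [NeZero L], 4 ≤ L → ∀ (f : Fin Nf) (x y : TorusSite 4 L) (r k : ℕ) (I J : Fin r →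
    TorusSite 4 L × Fin 3 × Fin 4) (I' J' : Fin k → TorusSite 4 L × Fin 3 × Fin 4), Function.Injective I → Function.Injective J →
    Function.Injective I' → Function.Injective J' → (∀ a b, I a ≠ I' b) → (∀ a b, J a ≠ J' b) → (∀ z, (∃ a, I a = z) ∨
    (∃ b, I' b = z)) → (∀ z, (∃ a, J a = z) ∨ (∃ b, J' b = z)) →
    let star : Edge 4 L → Prop := fun e => e.1 = x ∨ Site.shift e.1 e.2 = x ∨ e.1 = y ∨ Site.shift e.1 e.2 = y;
    let refit : GaugeConfig 4 L SU3 → GaugeConfig 4 L SU3 → GaugeConfig 4 L SU3 := fun U W e => if star e then W e else U e;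
    let Ff : GaugeConfig 4 L SU3 → ℝ := fun U => ‖fermionDet (wilsonDirac (fundamentalRep (Fin 3)) U (mq f) 1)‖;
    let G : GaugeConfig 4 L SU3 → ℝ := fun U => ∏ g ∈ Finset.univ.erase f, ‖fermionDet (wilsonDirac (fundamentalRep (Fin 3)) U (mq g) 1)‖;
    let wt : GaugeConfig 4 L SU3 → ℝ := fun U => Real.exp (-(β * wilsonAction (fundamentalRep (Fin 3)) U));
    let haar : Measure (GaugeConfig 4 L SU3) := Measure.pi fun _ => haarProbability SU3;
    let M : GaugeConfig 4 L SU3 → ℝ := fun U => (∫ W, Ff (refit U W) * G (refit U W) * wt (refit U W) ∂haar) / ∫ W, G (refit U W) * wt (refit U W) ∂haar;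
    ∫⁻ U, ENNReal.ofReal (‖(Matrix.of fun a b : Fin r => (diracMatrix U mq)⁻¹ (quarkEquiv (f, I a)) (quarkEquiv (f, J b))).det‖ ^
    (1 + ε) * (Ff U * G U * wt U)) ∂haar ≤ ENNReal.ofReal K * ∫⁻ U, ENNReal.ofReal (((⨆ W, ‖((wilsonDirac (fundamentalRep (Fin 3)) (refit U W) (mq f) 1).submatrix J' I').det‖) /
    M U) ^ (1 + ε) * (Ff U * G U * wt U)) ∂haar := by
  intro Nf βmax hβmax
  obtain ⟨ε₀, hε₀, hε⟩ := hFMR Nf βmax hβmax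
  refine ⟨ε₀, hε₀, fun ε hεpos hεlt => ?_⟩
  obtain ⟨K, hK, hmain⟩ := hε ε hεpos hεlt
  refine ⟨K, hK, ?_⟩
  intro β hβ hββ mq hmq L _ hL f x y r k I J I' J' hI hJi hI' hJ' hII' hJJ' hcovI hcovJ star refit Ff G wt haar M
  have ha_cont : Continuous fun pr : GaugeConfig 4 L SU3 × GaugeConfig 4 L SU3 =>
      ‖((wilsonDirac (fundamentalRep (Fin 3)) (refit pr.2 pr.1) (mq f) 1).submatrix J' I').det‖ :=
    continuous_norm_det_submatrix_wilsonDirac_refit star (mq f) J' I'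
  obtain ⟨B, hB⟩ : ∃ B : ℝ, ∀ W U : GaugeConfig 4 L SU3,
      ‖((wilsonDirac (fundamentalRep (Fin 3)) (refit U W) (mq f) 1).submatrix J' I').det‖ ≤ B := by
    obtain ⟨B, hB⟩ := isCompact_univ.bddAbove_image ha_cont.continuousOn
    exact ⟨B, fun W U => hB ⟨(W, U), Set.mem_univ _, rfl⟩⟩
  have hbdd : ∀ U : GaugeConfig 4 L SU3, BddAbove (Set.range fun W : GaugeConfig 4 L SU3 =>
      ‖((wilsonDirac (fundamentalRep (Fin 3)) (refit U W) (mq f) 1).submatrix J' I').det‖) := fun U =>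
    ⟨B, by rintro _ ⟨W, rfl⟩; exact hB W U⟩
  have hrefit_self : ∀ U, refit U U = U := by
    intro U; funext e
    by_cases he : star e
    · simp only [refit, if_pos he]
    · simp only [refit, if_neg he]
  have hrefit_refit : ∀ U W W' : GaugeConfig 4 L SU3, refit (refit U W) W' = refit U W' := by
    intro U W W'; funext e
    by_cases he : star e
    · simp only [refit, if_pos he]
    · simp only [refit, if_neg he]
  refine hmain β hβ hββ mq hmq L hL f x y
    (fun U => ‖(Matrix.of fun a b : Fin r => (diracMatrix U mq)⁻¹ (quarkEquiv (f, I a)) (quarkEquiv (f, J b))).det‖)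
    (fun U => ⨆ W, ‖((wilsonDirac (fundamentalRep (Fin 3)) (refit U W) (mq f) 1).submatrix J' I').det‖)
    (measurable_det_inv_diracMatrix (S := L) mq (fun a => quarkEquiv (f, I a)) (fun b => quarkEquiv (f, J b))).norm
    ((lowerSemicontinuous_ciSup hbdd fun W =>
      (ha_cont.comp (Continuous.prodMk_right W)).lowerSemicontinuous).measurable)
    (fun U => norm_nonneg _)
    (fun U => (norm_nonneg _).trans (le_ciSup (hbdd U) U))
    (fun U => ?_) (fun U W => ?_)
  · refine (norm_det_inv_diracMatrix_minor_mul_norm_det_le hJ U mq f I J I' J' hI hJi hI' hJ' hII' hJJ' hcovI hcovJ).trans ?_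
    have h := le_ciSup (hbdd U) U
    simpa only [hrefit_self] using h
  · change (⨆ W', ‖((wilsonDirac (fundamentalRep (Fin 3)) (refit (refit U W) W') (mq f) 1).submatrix J' I').det‖) = _
    simp only [hrefit_refit]

/-- Registered stub `stub_minorMomentFibreBound` (crux stmt-QuantumFields-9151, line `crossing-split-integrability`): ALL single-flavour
Wick minors, unconditionally (let-free spelling of `minorMomentFibreBound_of stub_jacobiMinorNorm fibreMomentReduction`): for
`β ∈ [0,β_max]`, masses in `[-2,2]`, `L ≥ 4`, injective row/column maps `I, J` (complements `I', J'`), the `(1+ε)`-moment weight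
integral of `‖det[(D⁻¹)((f,I a),(f,J b))]‖` is at most `K(N_f, β_max, ε)` times that of `(sup_W ‖det D_f(refit U W)[J',I']‖ / M_f(U))^{1+ε}`. -/
theorem stub_minorMomentFibreBound :
    ∀ (Nf : ℕ) (βmax : ℝ), 0 ≤ βmax → ∃ ε₀ : ℝ, 0 < ε₀ ∧ ∀ ε : ℝ, 0 < ε → ε < ε₀ → ∃ K : ℝ, 0 < K ∧ ∀ β : ℝ, 0 ≤ β →
    β ≤ βmax → ∀ mq : Fin Nf → ℝ, (∀ f, -2 ≤ mq f ∧ mq f ≤ 2) → ∀ (L : ℕ) [NeZero L], 4 ≤ L → ∀ (f : Fin Nf) (x y : TorusSite 4 L) (r k : ℕ) (I J : Fin r →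
    TorusSite 4 L × Fin 3 × Fin 4) (I' J' : Fin k → TorusSite 4 L × Fin 3 × Fin 4), Function.Injective I → Function.Injective J →
    Function.Injective I' → Function.Injective J' → (∀ a b, I a ≠ I' b) → (∀ a b, J a ≠ J' b) → (∀ z, (∃ a, I a = z) ∨
    (∃ b, I' b = z)) → (∀ z, (∃ a, J a = z) ∨ (∃ b, J' b = z)) → ∫⁻ U, ENNReal.ofReal (‖(Matrix.of fun a b : Fin r =>
    (diracMatrix U mq)⁻¹ (quarkEquiv (f, I a)) (quarkEquiv (f, J b))).det‖ ^ (1 + ε) * (‖fermionDet (wilsonDirac (fundamentalRep (Fin 3)) U (mq f) 1)‖ *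
    (∏ g ∈ Finset.univ.erase f, ‖fermionDet (wilsonDirac (fundamentalRep (Fin 3)) U (mq g) 1)‖) * Real.exp (-(β * wilsonAction (fundamentalRep (Fin 3)) U)))) ∂(Measure.pi fun _ : Edge 4 L =>
    haarProbability SU3) ≤ ENNReal.ofReal K * ∫⁻ U, ENNReal.ofReal (((⨆ W : GaugeConfig 4 L SU3, ‖((wilsonDirac (fundamentalRep (Fin 3)) (fun e =>
    if e.1 = x ∨ Site.shift e.1 e.2 = x ∨ e.1 = y ∨ Site.shift e.1 e.2 = y then W e else U e) (mq f) 1).submatrix J' I').det‖) /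
    ((∫ W, ‖fermionDet (wilsonDirac (fundamentalRep (Fin 3)) (fun e => if e.1 = x ∨ Site.shift e.1 e.2 = x ∨ e.1 = y ∨
    Site.shift e.1 e.2 = y then W e else U e) (mq f) 1)‖ * (∏ g ∈ Finset.univ.erase f, ‖fermionDet (wilsonDirac (fundamentalRep (Fin 3)) (fun e =>
    if e.1 = x ∨ Site.shift e.1 e.2 = x ∨ e.1 = y ∨ Site.shift e.1 e.2 = y then W e else U e) (mq g) 1)‖) * Real.exp (-(β *
    wilsonAction (fundamentalRep (Fin 3)) (fun e => if e.1 = x ∨ Site.shift e.1 e.2 = x ∨ e.1 = y ∨ Site.shift e.1 e.2 =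
    y then W e else U e))) ∂(Measure.pi fun _ : Edge 4 L => haarProbability SU3)) / ∫ W, (∏ g ∈ Finset.univ.erase f,
    ‖fermionDet (wilsonDirac (fundamentalRep (Fin 3)) (fun e => if e.1 = x ∨ Site.shift e.1 e.2 = x ∨ e.1 = y ∨ Site.shift e.1 e.2 =
    y then W e else U e) (mq g) 1)‖) * Real.exp (-(β * wilsonAction (fundamentalRep (Fin 3)) (fun e => if e.1 = x ∨ Site.shift e.1 e.2 =
    x ∨ e.1 = y ∨ Site.shift e.1 e.2 = y then W e else U e))) ∂(Measure.pi fun _ : Edge 4 L => haarProbability SU3))) ^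
    (1 + ε) * (‖fermionDet (wilsonDirac (fundamentalRep (Fin 3)) U (mq f) 1)‖ * (∏ g ∈ Finset.univ.erase f, ‖fermionDet (wilsonDirac (fundamentalRep (Fin 3)) U (mq g) 1)‖) *
    Real.exp (-(β * wilsonAction (fundamentalRep (Fin 3)) U)))) ∂(Measure.pi fun _ : Edge 4 L => haarProbability SU3) :=
  minorMomentFibreBound_of stub_jacobiMinorNorm fibreMomentReduction

end Summit.QuantumFields.QCD.Cruxes.PhaseQuenchedFlavourDecay.CrossingSplitIntegrability

end
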